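import Summits.RiemannHypothesis.RiemannHypothesis.Theses.ScrewPolyaSigns
import Summits.RiemannHypothesis.RiemannHypothesis.Theorems.PolyaLandauRung

/-!
# BC5 rung of `PolyaLandauR` (item stmt-RiemannHypothesis-24464): the case `D = 0`

With no sign changes beyond a bounded number (`D = 0`), Pólya's Satz 3 is Landau's theorem:
the landed rung `PolyaLandauRung.stub_rung_D0` (p590866) gives absolute convergence of
`mellinIoi g` on every half-plane `{θ - η/2 < re}`, hence a holomorphic extension (`Φ' = mellinIoi g`).
The meromorphy hypothesis is not needed in this degenerate case.
-/

open Set MeasureTheory Filter Literature.NumberTheory.LFunctions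

namespace Summit.RiemannHypothesis.RiemannHypothesis.Theorems.PolyaLandauRRung

/-- A function continuous on the open set `Ioi 1` has a Borel-measurable modification off `Ioi 1`
(its indicator). [folklore] -/
theorem measurable_indicator_of_continuousOn {g : ℝ → ℝ} (hg : ContinuousOn g (Ioi 1)) :
    Measurable ((Ioi (1:ℝ)).indicator g) := by
  refine measurable_of_isOpen fun V hV ↦ ?_
  have h1 : IsOpen (Ioi (1:ℝ) ∩ g ⁻¹' V) := hg.isOpen_inter_preimage isOpen_Ioi hV
  by_cases h0 : (0:ℝ) ∈ V
  · have : (Ioi (1:ℝ)).indicator g ⁻¹' V = (Ioi (1:ℝ) ∩ g ⁻¹' V) ∪ (Ioi (1:ℝ))ᶜ := by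
      ext x
      simp only [Set.mem_preimage, Set.mem_union, Set.mem_inter_iff, Set.mem_compl_iff]
      by_cases hx : x ∈ Ioi (1:ℝ)
      · rw [Set.indicator_of_mem hx]; tauto
      · rw [Set.indicator_of_notMem hx]; tauto
    rw [this]
    exact h1.measurableSet.union measurableSet_Ioi.compl
  · have : (Ioi (1:ℝ)).indicator g ⁻¹' V = (Ioi (1:ℝ) ∩ g ⁻¹' V) := by
      ext x
      simp only [Set.mem_preimage, Set.mem_inter_iff]
      by_cases hx : x ∈ Ioi (1:ℝ)
      · rw [Set.indicator_of_mem hx]; tauto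
      · rw [Set.indicator_of_notMem hx]; tauto
    rw [this]
    exact h1.measurableSet

/-- `mellinIoi` only sees `g` on `Ioi 1`. [folklore] -/
theorem mellinIoi_indicator (g : ℝ → ℝ) :
    Landau.mellinIoi ((Ioi (1:ℝ)).indicator g) = Landau.mellinIoi g := by
  funext s
  unfold Landau.mellinIoi
  refine setIntegral_congr_fun measurableSet_Ioi fun x hx ↦ ?_
  simp [Set.indicator_of_mem hx]

/-- **BC5 rung (`D = 0`) of `ScrewPolyaSigns.PolyaLandauR`**: the statement of item 24464 with the
sign-change slope `D = 0` (finitely many sign changes), proved from the landed Landau rung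
`PolyaLandauRung.stub_rung_D0` and `Landau.differentiableOn_mellinIoi_of_forall`; the extension is
`Φ' = mellinIoi g` itself on `{θ - η/2 < re}`. [this file] -/
theorem polyaLandauR_rung_D0 (g : ℝ → ℝ) (σ₁ θ b η B : ℝ) (hg : ContinuousOn g (Set.Ioi 1))
    (hint : MeasureTheory.IntegrableOn (fun x : ℝ ↦ g x * x ^ (-(σ₁ + 1))) (Set.Ioi 1))
    (hchain : ∀ X : ℝ, 1 ≤ X → ∀ (n : ℕ) (x : Fin (n + 1) → ℝ), StrictMono x →
        (∀ i, x i ∈ Set.Ioc 1 X) → (∀ i : Fin n, g (x i.castSucc) * g (x i.succ) < 0) →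
        (n : ℝ) ≤ 0 * Real.log X + B)
    (hθ : θ ≤ σ₁) (_hb : 0 < b) (hη : 0 < η)
    (Φ : ℂ → ℂ) (_hmero : MeromorphicOn Φ {s : ℂ | θ - b < s.re})
    (hΦ : DifferentiableOn ℂ Φ
      ({s : ℂ | θ < s.re} ∪ {s : ℂ | θ - η < s.re ∧ |s.im| < Real.pi * 0 + η}))
    (hagree : Set.EqOn Φ (Literature.NumberTheory.LFunctions.Landau.mellinIoi g)
      {s : ℂ | σ₁ < s.re}) :
    ∃ ε : ℝ, 0 < ε ∧ ∃ Φ' : ℂ → ℂ, DifferentiableOn ℂ Φ' {s : ℂ | θ - ε < s.re} ∧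
      Set.EqOn Φ' (Literature.NumberTheory.LFunctions.Landau.mellinIoi g) {s : ℂ | σ₁ < s.re} := by
  -- work with the measurable modification `g₁ = 1_{Ioi 1} · g`
  set g₁ : ℝ → ℝ := (Ioi (1:ℝ)).indicator g with hg₁
  have hg₁m : Measurable g₁ := measurable_indicator_of_continuousOn hg
  have hmell : Landau.mellinIoi g₁ = Landau.mellinIoi g := mellinIoi_indicator g
  have hint₁ : ∀ τ : ℝ, IntegrableOn (fun x : ℝ ↦ g x * x ^ (-(τ + 1))) (Ioi 1) ↔
      IntegrableOn (fun x : ℝ ↦ g₁ x * x ^ (-(τ + 1))) (Ioi 1) := by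
    intro τ
    refine integrableOn_congr_fun (fun x hx ↦ ?_) measurableSet_Ioi
    simp [hg₁, Set.indicator_of_mem hx]
  have hchain₁ : ∀ X : ℝ, 1 ≤ X → ∀ (n : ℕ) (x : Fin (n + 1) → ℝ), StrictMono x →
      (∀ i, x i ∈ Set.Ioc 1 X) → (∀ i : Fin n, g₁ (x i.castSucc) * g₁ (x i.succ) < 0) →
      (n : ℝ) ≤ 0 * Real.log X + B := by
    intro X hX n x hx hmem halt
    refine hchain X hX n x hx hmem fun i ↦ ?_
    have h1 : x i.castSucc ∈ Ioi (1:ℝ) := (hmem i.castSucc).1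
    have h2 : x i.succ ∈ Ioi (1:ℝ) := (hmem i.succ).1
    have := halt i
    simpa [hg₁, Set.indicator_of_mem h1, Set.indicator_of_mem h2] using this
  -- the convex open window around the real segment `(θ - η/2, σ₁ + 1]`
  set a : ℝ := θ - η / 2 with ha_def
  have ha : a < σ₁ := by rw [ha_def]; linarith
  set W₀ : Set ℂ := {s : ℂ | θ - η < s.re} ∩ ({s : ℂ | |s.im| < η} ∩ {s : ℂ | s.re < σ₁ + 2})
    with hW₀
  have hW₀o : IsOpen W₀ :=
    (isOpen_lt continuous_const Complex.continuous_re).inter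
      ((isOpen_lt (continuous_abs.comp Complex.continuous_im) continuous_const).inter
        (isOpen_lt Complex.continuous_re continuous_const))
  have hW₀c : Convex ℝ W₀ := by
    refine (convex_halfSpace_gt Complex.reLm.isLinear _).inter
      (Convex.inter ?_ (convex_halfSpace_lt Complex.reLm.isLinear _))
    -- `{|im| < η}` is convex: intersection of two half-spaces
    have e2 : {s : ℂ | |s.im| < η} = {s : ℂ | s.im < η} ∩ {s : ℂ | -η < s.im} := by
      ext s; simp [abs_lt, and_comm]
    rw [e2]
    exact (convex_halfSpace_lt Complex.imLm.isLinear _).inter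
      (convex_halfSpace_gt Complex.imLm.isLinear _)
  have hW₀r : {s : ℂ | a < s.re ∧ s.re ≤ σ₁ + 1 ∧ |s.im| ≤ Real.pi * 0} ⊆ W₀ := by
    intro s hs
    simp only [mul_zero, Set.mem_setOf_eq] at hs
    obtain ⟨h1, h2, h3⟩ := hs
    have him : s.im = 0 := abs_nonpos_iff.mp h3
    refine ⟨?_, ?_, ?_⟩
    · show θ - η < s.re
      rw [ha_def] at h1; linarith
    · show |s.im| < η
      simp [him, hη]
    · show s.re < σ₁ + 2
      linarith
  have hΦ' : DifferentiableOn ℂ Φ ({s : ℂ | σ₁ < s.re} ∪ W₀) := by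
    refine hΦ.mono fun s hs ↦ ?_
    rcases hs with hs | hs
    · left
      show θ < s.re
      have : σ₁ < s.re := hs
      linarith
    · right
      have h1 : θ - η < s.re := hs.1
      have h2 : |s.im| < η := hs.2.1
      show θ - η < s.re ∧ |s.im| < Real.pi * 0 + η
      simpa using ⟨h1, h2⟩
  have hagree₁ : EqOn Φ (Landau.mellinIoi g₁) {s : ℂ | σ₁ < s.re} := by
    rw [hmell]; exact hagree
  -- Landau rung: absolute convergence for every `σ > a`
  have hconv : ∀ σ : ℝ, a < σ → IntegrableOn (fun x : ℝ ↦ g₁ x * x ^ (-(σ + 1))) (Ioi 1) :=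
    fun σ hσ ↦ PolyaLandauRung.stub_rung_D0 g₁ σ₁ a B hg₁m ((hint₁ σ₁).1 hint) hchain₁ ha W₀
      hW₀o hW₀c hW₀r Φ hΦ' hagree₁ σ hσ
  -- hence `mellinIoi g` is holomorphic on `{a < re}`
  refine ⟨η / 2, by linarith, Landau.mellinIoi g, ?_, fun s _ ↦ rfl⟩
  have hdiff : DifferentiableOn ℂ (Landau.mellinIoi g₁) {s : ℂ | a < s.re} :=
    Landau.differentiableOn_mellinIoi_of_forall hg₁m hconv
  rw [hmell] at hdiff
  convert hdiff using 3

end Summit.RiemannHypothesis.RiemannHypothesis.Theorems.PolyaLandauRRung
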